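import Literature.MathematicalPhysics.QuantumLattice.DownfoldingIdentities

/-!
# The static low-energy model of a dynamically screened interaction: `U(0)` AND a bandwidth
# renormalised by the boson factor `Z_B` (Casula–Werner–Vaugier–Aryasetiawan–Miyake–Millis–Biermann 2012)

A cRPA-downfolded interaction is frequency dependent, `U(ω)`, rising from the static screened
value `U₀ = U(0)` to the bare `V` above the screening (plasmon / sub-plasmon) modes.  Casula et al.
show that the low-energy model is NOT the static Hubbard model with `U₀` and the DFT bands, but
that model with every hopping renormalised, `t ↦ Z_B t` [CasulaEtAl2012, Eqs. (2)–(4)]: writing the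
retarded `U(ω)` as a Hubbard–Holstein coupling to boson modes (one mode: frequency `ω₀`, coupling
`λ`), a Lang–Firsov transformation gives `U₀ = V − 2λ²/ω₀` [Eq. (3)] and, projected on the
zero-boson sector, `H_eff = −Z_B Σ t_{ij} d†d + U₀ Σ n↑n↓` with `Z_B = exp(−λ²/ω₀²)` [Eq. (4)];
for a continuum of modes `U₀ = V + (2/π)∫₀^∞ Im U(ν)/ν dν` [Eq. (8)],
`Z_B = exp((1/π)∫₀^∞ Im U(ν)/ν² dν)` [Eq. (9)], and «matching this to the single mode formula
implies a characteristic frequency» `ω₀ = ∫ν Im U/ν² / ∫ Im U/ν²` [Eq. (10)]; in a `dp` model the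
`d` operators carry `√Z_B`, so `T_pp ↦ T_pp`, `T_pd ↦ √Z_B T_pd`, `T_dd ↦ Z_B T_dd` [Eq. (7)].
Printed one-band values: La₂CuO₄ `U₀ = 3.65 eV`, bare `≈ 20 eV`, modes at `9, 13, 21, 30 eV`,
`Z_B = 0.58`; HgBa₂CuO₄ `Z_B = 0.66` [WernerEtAl2015, §III.A]; `Z_B ≈ 0.6–0.7` for oxides and
pnictides [CasulaEtAl2012, Table III].

What is typed here (everything PROVED, no named facts; reals, finitely many modes = the
discretised continuum of Eq. (8)–(10)):
* §1 one mode: `screenedU`, `zB`; `0 < Z_B ≤ 1`; screening lowers `U`; the MATCHING identity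
  `Z_B = exp(−(V − U₀)/(2ω₀))` (`zB_eq_zBStatic`) — `Z_B` is determined by the static reduction
  `ΔU = V − U₀` and the mode frequency; `zBStatic ΔU ω₀ := exp(−ΔU/(2ω₀))` is antitone in `ΔU`,
  monotone in `ω₀`, and inverts to `log Z_B = −ΔU/(2ω₀)`.
* §2 finitely many modes `(λᵢ, ωᵢ)`: `ΔU = Σ 2λᵢ²/ωᵢ`, `−log Z_B = Σ λᵢ²/ωᵢ²`,
  `ω̄ = (Σλᵢ²/ωᵢ)/(Σλᵢ²/ωᵢ²)`; the one-mode formula is EXACT with `ω₀ := ω̄`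
  (`zBModes_eq_zBStatic`, the content of Eq. (10)); `ω̄` is a weighted mean of the `ωᵢ` hence
  lies in `[ω_min, ω_max]`; and the two-sided ENCLOSURE
  `exp(−ΔU/(2ω_min)) ≤ Z_B ≤ exp(−ΔU/(2ω_max))` (`zBModes_mem_Icc`) — what a box needs when only
  `V`, `U₀` and the frequency range of `Im U` are printed.
* §3 the renormalised static model as a model at coupling `U₀/(Z_B t)`: `Z•T + U₀•D =
  Z•(T + (U₀/Z)•D)` (`effModel_smul`), `U₀/t ≤ U₀/(Z_B t)` (`div_le_uEff`), and the printed
  La₂CuO₄ instance `U₀/Z_B = 3.65/0.58 ∈ (6.29, 6.30) eV` («this factor essentially tells us by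
  how much the static limit underestimates the interaction strength» [WernerEtAl2015, §III.A]) with
  the enclosure check `exp(−16.35/18) ≤ 0.58 ≤ exp(−16.35/60)` on the printed round numbers.
* §4 Eq. (7) meets Löwdin (G1 of the cell's pipeline, `loewdinHam` of
  `DownfoldingIdentities.lean`): eliminating the `p` block at energy `ω` from the renormalised
  `dp` one-body matrix gives EXACTLY `ε_d•1 + Z_B•(H_eff^bare(ω) − ε_d•1)` (`loewdinHam_renormHop`):
  the oxygen-mediated `d–d` paths pick up `√Z_B·√Z_B = Z_B` like the direct ones, so at fixed `ω`
  the downfolded one-band operator measured from the unrenormalised `d` level is uniformly scaled —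
  the one-band prescription `t ↦ Z_B t` and the `dp` prescription (7) agree at the Löwdin level.

* §5 the CONTINUUM form of Eqs. (8)–(10) (interval integrals): for a retarded `Im U ≤ 0`
  supported in `[a, b] ⊂ (0, ∞)` and interval-integrable, `deltaUCont`, `bosonWeightCont`,
  `zBCont`, `omegaCharCont`; the matching identity `zBCont_eq_zBStatic`, `ΔU ≥ 0`, the enclosure
  `exp(−ΔU/(2a)) ≤ Z_B ≤ exp(−ΔU/(2b))` (`zBCont_mem_Icc`) and `ω₀ ∈ [a, b]`
  (`omegaCharCont_mem_Icc`).

* §6 the single-pole MATSUBARA form `U(iν) = V − 2g²E/(ν² + E²)` by which the (K) cuprate dataset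
  [VucicevicEtAl2026, Eq. (5)] parametrises cRPA `U(iν)` as a Hubbard/Emery–Holstein model
  (`ω = E`, `g = √A`): the pole pair is real on the Matsubara axis (`polePair_eq`,
  `eq5_eq_matsubaraU`), static value `= screenedU` (`matsubaraU_zero`), even, monotone in `ν²`
  between `U₀` and `V`, the invariant `(V − U(iν))(ν² + E²) = 2g²E`, and `Z_B = zB g E`
  through the matching identity (`zB_eq_zBStatic_matsubaraU`); §6b the TWO-POINT inversion
  `E² = ν²Δ(ν)/(Δ(0) − Δ(ν))` (`poleSq_eq_of_two_values`) by which a table printing `V`, `U(0)`,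
  `U(iν₀)` carries its own one-pole, and `Z_B = exp(−Δ(0)/(2E))` for it (`zB_twoPoint`); §6c the
  same construction on a MULTI-mode `U(iν)`: the two-point pole is a weighted mean of the `ωᵢ²`
  (`twoPointPoleSq_mul`), its `ν → 0` value `E₀` and tail value `E_∞` satisfy `E₀ ≤ ω̄ ≤ E_∞`
  (Cauchy–Schwarz), hence `exp(−ΔU/(2E₀)) ≤ Z_B ≤ exp(−ΔU/(2E_∞))`
  (`zBModes_mem_Icc_twoPoint`).

NOT here: the Lang–Firsov operator algebra itself (Eqs. (2)–(4) are the SOURCE of the definitions,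
not re-derived), the many-body accuracy of the zero-boson projection (Tables I–II), the
self-consistency `ω = E` of downfolded eigenvalues (only the operator at fixed `ω` scales), any
statement that a particular material's `Z_B`-renormalised coupling is the right box member (the
cell's mod seats decide; this file supplies the exact arithmetic and the enclosure).

References: M. Casula, Ph. Werner, L. Vaugier, F. Aryasetiawan, T. Miyake, A. J. Millis,
S. Biermann, Phys. Rev. Lett. 109 (2012) 126408 (arXiv:1204.4900) · Ph. Werner, R. Sakuma,
F. Nilsson, F. Aryasetiawan, Phys. Rev. B 91 (2015) 125142 (arXiv:1411.3952) §III.A · J. Vučičević,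
U. Kumar, C.-N. Yeh, M. A. Morales, M. Rösner, arXiv:2606.21323 (2026) §VII.D Eq. (5).
AI-produced formalisation (H21, cell hubbard-downfold, seat lit-1, 2026-08-27).
-/

noncomputable section

open scoped BigOperators

namespace Literature.MathematicalPhysics.QuantumLattice

namespace DynU

/-! ## 1. One boson mode -/

/-- Static screened interaction of the one-mode Hubbard–Holstein representation of `U(ω)`:
`U₀ = V − 2λ²/ω₀`. [cite: CasulaEtAl2012, Eq. (3)] -/
def screenedU (V lam ω₀ : ℝ) : ℝ := V - 2 * lam ^ 2 / ω₀

/-- The boson (Lang–Firsov) bandwidth-renormalisation factor of one mode, `Z_B = exp(−λ²/ω₀²)`.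
[cite: CasulaEtAl2012, Eq. (4)] -/
def zB (lam ω₀ : ℝ) : ℝ := Real.exp (-(lam ^ 2 / ω₀ ^ 2))

/-- `Z_B` as READ from static data: `exp(−ΔU/(2ω₀))` with `ΔU = V − U₀` the static reduction and
`ω₀` the (characteristic) mode frequency. [cite: CasulaEtAl2012, Eqs. (3)–(4) and (10)] -/
def zBStatic (dU ω₀ : ℝ) : ℝ := Real.exp (-(dU / (2 * ω₀)))

/-- [cite: CasulaEtAl2012, Eq. (3)] Unfolding lemma. -/
theorem screenedU_def (V lam ω₀ : ℝ) : screenedU V lam ω₀ = V - 2 * lam ^ 2 / ω₀ := rfl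

/-- [cite: CasulaEtAl2012, Eq. (4)] Unfolding lemma. -/
theorem zB_def (lam ω₀ : ℝ) : zB lam ω₀ = Real.exp (-(lam ^ 2 / ω₀ ^ 2)) := rfl

/-- [cite: CasulaEtAl2012, Eq. (4)] Unfolding lemma. -/
theorem zBStatic_def (dU ω₀ : ℝ) : zBStatic dU ω₀ = Real.exp (-(dU / (2 * ω₀))) := rfl

/-- [cite: CasulaEtAl2012, Eq. (4)] `Z_B > 0`. -/
theorem zB_pos (lam ω₀ : ℝ) : 0 < zB lam ω₀ := Real.exp_pos _

/-- [cite: CasulaEtAl2012, Eq. (4)] `Z_B ≤ 1`: the boson factor never widens the band. -/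
theorem zB_le_one (lam ω₀ : ℝ) : zB lam ω₀ ≤ 1 := by
  unfold zB
  rw [Real.exp_le_one_iff]
  have : 0 ≤ lam ^ 2 / ω₀ ^ 2 := by positivity
  linarith

/-- [cite: CasulaEtAl2012, Eq. (4)] `Z_B < 1` as soon as there is a coupled mode
(`λ ≠ 0`, `ω₀ ≠ 0`). -/
theorem zB_lt_one {lam ω₀ : ℝ} (hl : lam ≠ 0) (hω : ω₀ ≠ 0) : zB lam ω₀ < 1 := by
  unfold zB
  rw [Real.exp_lt_one_iff]
  have : 0 < lam ^ 2 / ω₀ ^ 2 := by positivity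
  linarith

/-- [cite: CasulaEtAl2012, Eq. (4)] No coupling ⇒ no renormalisation: `Z_B(λ = 0) = 1`. -/
theorem zB_zero_left (ω₀ : ℝ) : zB 0 ω₀ = 1 := by
  simp [zB]

/-- [cite: CasulaEtAl2012, Eq. (3)] Screening LOWERS the static interaction: `U₀ ≤ V` (`ω₀ > 0`). -/
theorem screenedU_le (V lam : ℝ) {ω₀ : ℝ} (hω : 0 < ω₀) : screenedU V lam ω₀ ≤ V := by
  unfold screenedU
  have : 0 ≤ 2 * lam ^ 2 / ω₀ := by positivity
  linarith

/-- [cite: CasulaEtAl2012, Eq. (3)] The static reduction `ΔU = V − U₀ = 2λ²/ω₀`. -/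
theorem sub_screenedU (V lam ω₀ : ℝ) : V - screenedU V lam ω₀ = 2 * lam ^ 2 / ω₀ := by
  unfold screenedU
  ring

/-- **Matching identity** [cite: CasulaEtAl2012, Eqs. (3)–(4)]: the boson factor is determined by
the static reduction and the mode frequency, `Z_B = exp(−(V − U₀)/(2ω₀))`
(`λ²/ω₀² = (2λ²/ω₀)/(2ω₀)`). -/
theorem zB_eq_zBStatic (V lam : ℝ) {ω₀ : ℝ} (hω : ω₀ ≠ 0) :
    zB lam ω₀ = zBStatic (V - screenedU V lam ω₀) ω₀ := by
  rw [sub_screenedU]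
  unfold zB zBStatic
  congr 1
  field_simp

/-- [cite: CasulaEtAl2012, Eq. (4)] `zBStatic > 0`. -/
theorem zBStatic_pos (dU ω₀ : ℝ) : 0 < zBStatic dU ω₀ := Real.exp_pos _

/-- [cite: CasulaEtAl2012, Eq. (4)] `zBStatic ≤ 1` for a reduction `ΔU ≥ 0` and `ω₀ > 0`. -/
theorem zBStatic_le_one {dU ω₀ : ℝ} (hdU : 0 ≤ dU) (hω : 0 < ω₀) : zBStatic dU ω₀ ≤ 1 := by
  unfold zBStatic
  rw [Real.exp_le_one_iff]
  have : 0 ≤ dU / (2 * ω₀) := by positivity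
  linarith

/-- [cite: CasulaEtAl2012, Eq. (4)] Inverse reading: `log Z_B = −ΔU/(2ω₀)` — from printed
`(V, U₀, Z_B)` the characteristic frequency is `ω₀ = ΔU/(2 log(1/Z_B))`. -/
theorem log_zBStatic (dU ω₀ : ℝ) : Real.log (zBStatic dU ω₀) = -(dU / (2 * ω₀)) := by
  unfold zBStatic
  exact Real.log_exp _

/-- [cite: CasulaEtAl2012, Eq. (4)] `ω₀` recovered from `(ΔU, Z_B)`: if `Z = zBStatic ΔU ω₀` with
`ω₀ ≠ 0` and `Z ≠ 1` then `ω₀ = −ΔU/(2 log Z)`. -/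
theorem omega_eq_of_zBStatic {dU ω₀ Z : ℝ} (hω : ω₀ ≠ 0) (hZ : Z = zBStatic dU ω₀)
    (hlog : Real.log Z ≠ 0) : ω₀ = -(dU / (2 * Real.log Z)) := by
  have h := log_zBStatic dU ω₀
  rw [← hZ] at h
  rw [h]
  have h2 : dU ≠ 0 := by
    intro hd
    apply hlog
    rw [h, hd]
    simp
  field_simp

/-- [cite: CasulaEtAl2012, Eq. (4)] More static screening at the same mode frequency ⇒ smaller
`Z_B`: `ΔU ↦ exp(−ΔU/(2ω₀))` is antitone (`ω₀ > 0`). -/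
theorem zBStatic_antitone_deltaU {ω₀ : ℝ} (hω : 0 < ω₀) :
    Antitone (fun dU => zBStatic dU ω₀) := by
  intro a b hab
  unfold zBStatic
  apply Real.exp_le_exp.mpr
  have : a / (2 * ω₀) ≤ b / (2 * ω₀) := by
    apply div_le_div_of_nonneg_right hab
    positivity
  linarith

/-- [cite: CasulaEtAl2012, Eq. (4)] The same static screening from HIGHER-frequency modes
renormalises less: `ω₀ ↦ exp(−ΔU/(2ω₀))` is monotone on `ω₀ > 0` (`ΔU ≥ 0`). -/
theorem zBStatic_monotoneOn_omega {dU : ℝ} (hdU : 0 ≤ dU) :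
    MonotoneOn (fun ω₀ => zBStatic dU ω₀) (Set.Ioi 0) := by
  intro a ha b hb hab
  unfold zBStatic
  apply Real.exp_le_exp.mpr
  have ha' : (0 : ℝ) < a := ha
  have : dU / (2 * b) ≤ dU / (2 * a) := by
    apply div_le_div_of_nonneg_left hdU (by positivity)
    linarith
  linarith

/-! ## 2. Finitely many modes (the discretised continuum of Eqs. (8)–(10)) -/

section Modes

variable {ι : Type*} [Fintype ι]

/-- Static reduction of a finite set of screening modes: `ΔU = V − U₀ = Σᵢ 2λᵢ²/ωᵢ`
(Eq. (8) with `Im U(ν) = −π Σᵢ λᵢ² δ(ν − ωᵢ)`). [cite: CasulaEtAl2012, Eq. (8)] -/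
def deltaU (lam ω : ι → ℝ) : ℝ := ∑ i, 2 * lam i ^ 2 / ω i

/-- Minus the log of the boson factor: `−log Z_B = Σᵢ λᵢ²/ωᵢ²` (Eq. (9), same discretisation).
[cite: CasulaEtAl2012, Eq. (9)] -/
def bosonWeight (lam ω : ι → ℝ) : ℝ := ∑ i, lam i ^ 2 / ω i ^ 2

/-- The boson factor of finitely many modes, `Z_B = exp(−Σᵢ λᵢ²/ωᵢ²) = Πᵢ exp(−λᵢ²/ωᵢ²)`.
[cite: CasulaEtAl2012, Eq. (9)] -/
def zBModes (lam ω : ι → ℝ) : ℝ := Real.exp (-(bosonWeight lam ω))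

/-- The characteristic frequency `ω̄ = (Σᵢ λᵢ²/ωᵢ)/(Σᵢ λᵢ²/ωᵢ²)`
(Eq. (10): `∫ν Im U/ν² / ∫ Im U/ν²`, same discretisation). [cite: CasulaEtAl2012, Eq. (10)] -/
def omegaChar (lam ω : ι → ℝ) : ℝ := (∑ i, lam i ^ 2 / ω i) / bosonWeight lam ω

/-- [cite: CasulaEtAl2012, Eq. (9)] `Z_B > 0`. -/
theorem zBModes_pos (lam ω : ι → ℝ) : 0 < zBModes lam ω := Real.exp_pos _

/-- [cite: CasulaEtAl2012, Eq. (9)] `0 ≤ Σ λᵢ²/ωᵢ²`. -/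
theorem bosonWeight_nonneg (lam ω : ι → ℝ) : 0 ≤ bosonWeight lam ω := by
  unfold bosonWeight
  exact Finset.sum_nonneg fun i _ => by positivity

/-- [cite: CasulaEtAl2012, Eq. (9)] `Z_B ≤ 1`. -/
theorem zBModes_le_one (lam ω : ι → ℝ) : zBModes lam ω ≤ 1 := by
  unfold zBModes
  rw [Real.exp_le_one_iff]
  have := bosonWeight_nonneg lam ω
  linarith

/-- [cite: CasulaEtAl2012, Eq. (9)] The boson factor FACTORISES over modes:
`Z_B = Πᵢ exp(−λᵢ²/ωᵢ²) = Πᵢ zB λᵢ ωᵢ`. -/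
theorem zBModes_eq_prod (lam ω : ι → ℝ) : zBModes lam ω = ∏ i, zB (lam i) (ω i) := by
  unfold zBModes bosonWeight zB
  rw [← Finset.sum_neg_distrib, Real.exp_sum]

/-- [cite: CasulaEtAl2012, Eq. (8)] `ΔU ≥ 0` when every mode frequency is positive. -/
theorem deltaU_nonneg (lam : ι → ℝ) {ω : ι → ℝ} (hω : ∀ i, 0 < ω i) : 0 ≤ deltaU lam ω := by
  unfold deltaU
  exact Finset.sum_nonneg fun i _ => by
    have := hω i
    positivity

/-- [cite: CasulaEtAl2012, Eq. (8)] `ΔU = 2 Σᵢ λᵢ²/ωᵢ`. -/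
theorem deltaU_eq (lam ω : ι → ℝ) : deltaU lam ω = 2 * ∑ i, lam i ^ 2 / ω i := by
  unfold deltaU
  rw [Finset.mul_sum]
  refine Finset.sum_congr rfl fun i _ => ?_
  ring

/-- [cite: CasulaEtAl2012, Eq. (10)] `ΔU = 2 ω̄ · (Σ λᵢ²/ωᵢ²)` (when the latter is non-zero). -/
theorem deltaU_eq_two_mul_omegaChar_mul (lam ω : ι → ℝ) (hW : bosonWeight lam ω ≠ 0) :
    deltaU lam ω = 2 * omegaChar lam ω * bosonWeight lam ω := by
  rw [deltaU_eq]
  unfold omegaChar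
  field_simp

/-- **Exactness of the one-mode formula with `ω₀ := ω̄`** [cite: CasulaEtAl2012, Eq. (10)]
(«Matching this to the single mode formula implies a characteristic frequency»): for any finite
mode content with `Σλᵢ²/ωᵢ ≠ 0`, `Z_B = exp(−ΔU/(2ω̄))`. -/
theorem zBModes_eq_zBStatic (lam ω : ι → ℝ) (hS : ∑ i, lam i ^ 2 / ω i ≠ 0)
    (hW : bosonWeight lam ω ≠ 0) :
    zBModes lam ω = zBStatic (deltaU lam ω) (omegaChar lam ω) := by
  unfold zBModes zBStatic
  congr 1
  rw [deltaU_eq]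
  unfold omegaChar
  field_simp

/-- [cite: CasulaEtAl2012, Eq. (10)] `ω̄` is a weighted MEAN of the mode frequencies (weights
`λᵢ²/ωᵢ² ≥ 0`): if `ω_min ≤ ωᵢ` for all `i` (all `ωᵢ > 0`, some weight) then `ω_min ≤ ω̄`. -/
theorem le_omegaChar (lam : ι → ℝ) {ω : ι → ℝ} {ωmin : ℝ} (hω : ∀ i, 0 < ω i)
    (hmin : ∀ i, ωmin ≤ ω i) (hW : 0 < bosonWeight lam ω) : ωmin ≤ omegaChar lam ω := by
  unfold omegaChar
  rw [le_div_iff₀ hW]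
  unfold bosonWeight
  rw [Finset.mul_sum]
  refine Finset.sum_le_sum fun i _ => ?_
  have hi := hω i
  have hm := hmin i
  have hl : 0 ≤ lam i ^ 2 := sq_nonneg _
  rw [show lam i ^ 2 / ω i = ω i * (lam i ^ 2 / ω i ^ 2) by field_simp]
  exact mul_le_mul_of_nonneg_right hm (by positivity)

/-- [cite: CasulaEtAl2012, Eq. (10)] … and if `ωᵢ ≤ ω_max` for all `i` then `ω̄ ≤ ω_max`. -/
theorem omegaChar_le (lam : ι → ℝ) {ω : ι → ℝ} {ωmax : ℝ} (hω : ∀ i, 0 < ω i)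
    (hmax : ∀ i, ω i ≤ ωmax) (hW : 0 < bosonWeight lam ω) : omegaChar lam ω ≤ ωmax := by
  unfold omegaChar
  rw [div_le_iff₀ hW]
  unfold bosonWeight
  rw [Finset.mul_sum]
  refine Finset.sum_le_sum fun i _ => ?_
  have hi := hω i
  have hm := hmax i
  rw [show lam i ^ 2 / ω i = ω i * (lam i ^ 2 / ω i ^ 2) by field_simp]
  exact mul_le_mul_of_nonneg_right hm (by positivity)

/-- [cite: CasulaEtAl2012, Eqs. (8)–(9)] Upper bound on the boson weight from the LOWEST mode:
`Σ λᵢ²/ωᵢ² ≤ ΔU/(2ω_min)` (`0 < ω_min ≤ ωᵢ`). -/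
theorem bosonWeight_le (lam : ι → ℝ) {ω : ι → ℝ} {ωmin : ℝ} (hωmin : 0 < ωmin)
    (hmin : ∀ i, ωmin ≤ ω i) : bosonWeight lam ω ≤ deltaU lam ω / (2 * ωmin) := by
  rw [deltaU_eq, mul_div_assoc]
  rw [show 2 * ((∑ i, lam i ^ 2 / ω i) / (2 * ωmin)) = (∑ i, lam i ^ 2 / ω i) / ωmin by
    field_simp]
  unfold bosonWeight
  rw [Finset.sum_div]
  refine Finset.sum_le_sum fun i _ => ?_
  have hm := hmin i
  have hi : 0 < ω i := lt_of_lt_of_le hωmin hm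
  rw [div_div, sq (ω i)]
  apply div_le_div_of_nonneg_left (sq_nonneg _) (by positivity)
  exact mul_le_mul_of_nonneg_left hm hi.le

/-- [cite: CasulaEtAl2012, Eqs. (8)–(9)] Lower bound on the boson weight from the HIGHEST mode:
`ΔU/(2ω_max) ≤ Σ λᵢ²/ωᵢ²` (`0 < ωᵢ ≤ ω_max`). -/
theorem le_bosonWeight (lam : ι → ℝ) {ω : ι → ℝ} {ωmax : ℝ} (hω : ∀ i, 0 < ω i)
    (hmax : ∀ i, ω i ≤ ωmax) (hωmax : 0 < ωmax) :
    deltaU lam ω / (2 * ωmax) ≤ bosonWeight lam ω := by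
  rw [deltaU_eq, mul_div_assoc]
  rw [show 2 * ((∑ i, lam i ^ 2 / ω i) / (2 * ωmax)) = (∑ i, lam i ^ 2 / ω i) / ωmax by
    field_simp]
  unfold bosonWeight
  rw [Finset.sum_div]
  refine Finset.sum_le_sum fun i _ => ?_
  have hi := hω i
  have hm := hmax i
  rw [div_div, sq (ω i)]
  apply div_le_div_of_nonneg_left (sq_nonneg _) (by positivity)
  exact mul_le_mul_of_nonneg_left hm hi.le

/-- **Two-sided enclosure of `Z_B` by the static reduction and the frequency RANGE of the
screening modes** [cite: CasulaEtAl2012, Eqs. (8)–(10)]: if every mode lies in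
`[ω_min, ω_max] ⊂ (0, ∞)` then `exp(−ΔU/(2ω_min)) ≤ Z_B ≤ exp(−ΔU/(2ω_max))`. -/
theorem zBModes_mem_Icc (lam : ι → ℝ) {ω : ι → ℝ} {ωmin ωmax : ℝ} (hωmin : 0 < ωmin)
    (hmin : ∀ i, ωmin ≤ ω i) (hmax : ∀ i, ω i ≤ ωmax) (hωmax : 0 < ωmax) :
    zBStatic (deltaU lam ω) ωmin ≤ zBModes lam ω ∧
      zBModes lam ω ≤ zBStatic (deltaU lam ω) ωmax := by
  have hω : ∀ i, 0 < ω i := fun i => lt_of_lt_of_le hωmin (hmin i)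
  unfold zBStatic zBModes
  constructor
  · apply Real.exp_le_exp.mpr
    have := bosonWeight_le lam hωmin hmin
    linarith
  · apply Real.exp_le_exp.mpr
    have := le_bosonWeight lam hω hmax hωmax
    linarith

end Modes

/-! ## 3. The renormalised static model is a model at coupling `U₀/(Z_B t)` -/

/-- Dimensionless coupling of the effective static model `−Z_B t Σ d†d + U₀ Σ n↑n↓`:
`u_eff = U₀/(Z_B t)`. [cite: CasulaEtAl2012, Eq. (4)] -/
def uEff (U₀ Z t : ℝ) : ℝ := U₀ / (Z * t)

/-- [cite: CasulaEtAl2012, Eq. (4)] Unfolding lemma. -/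
theorem uEff_def (U₀ Z t : ℝ) : uEff U₀ Z t = U₀ / (Z * t) := rfl

/-- [cite: CasulaEtAl2012, Eq. (4)] `u_eff = (U₀/Z_B)/t`: the renormalised model at `U₀` is the
unrenormalised-band model at the LARGER interaction `U₀/Z_B`. -/
theorem uEff_eq_div_div (U₀ Z t : ℝ) : uEff U₀ Z t = U₀ / Z / t := by
  unfold uEff
  rw [div_div]

/-- [cite: CasulaEtAl2012, Eq. (4)] No renormalisation (`Z_B = 1`) ⇒ the bare static coupling. -/
theorem uEff_one (U₀ t : ℝ) : uEff U₀ 1 t = U₀ / t := by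
  simp [uEff]

/-- [cite: CasulaEtAl2012, Eq. (4)] The static coupling UNDERESTIMATES the effective one:
`U₀/t ≤ U₀/(Z_B t)` for `0 < Z_B ≤ 1`, `t > 0`, `U₀ ≥ 0`. -/
theorem div_le_uEff {U₀ Z t : ℝ} (hU : 0 ≤ U₀) (hZ : 0 < Z) (hZ1 : Z ≤ 1) (ht : 0 < t) :
    U₀ / t ≤ uEff U₀ Z t := by
  unfold uEff
  apply div_le_div_of_nonneg_left hU (by positivity)
  calc Z * t ≤ 1 * t := mul_le_mul_of_nonneg_right hZ1 ht.le
    _ = t := one_mul t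

/-- [cite: CasulaEtAl2012, Eq. (4)] Exact scaling: in any real vector space of Hamiltonians,
`Z•T + U₀•D = Z•(T + (U₀/Z)•D)` (`Z ≠ 0`) — the spectrum of the renormalised model is `Z_B` times
that of the bare-band model at interaction `U₀/Z_B`. -/
theorem effModel_smul {E : Type*} [AddCommGroup E] [Module ℝ E] (T D : E) (U₀ : ℝ) {Z : ℝ}
    (hZ : Z ≠ 0) : Z • T + U₀ • D = Z • (T + (U₀ / Z) • D) := by
  rw [smul_add, smul_smul, mul_div_cancel₀ _ hZ]

/-- [cite: WernerEtAl2015, §III.A (one-band La₂CuO₄: U₀ = 3.65 eV, Z_B = 0.58)] `[float]` instance: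
the effective static interaction at DFT bandwidth is `U₀/Z_B = 3.65/0.58 ∈ (6.29, 6.30) eV`, and for
HgBa₂CuO₄'s `Z_B = 0.66` the lever is `1/0.66 ∈ (1.51, 1.52)`. -/
theorem la2CuO4_oneBand_U0_div_zB_float :
    (6.29 : ℝ) < 3.65 / 0.58 ∧ (3.65 : ℝ) / 0.58 < 6.30 ∧
      (1.51 : ℝ) < 1 / 0.66 ∧ (1 : ℝ) / 0.66 < 1.52 := by
  norm_num

/-- [cite: WernerEtAl2015, §III.A (one-band La₂CuO₄: U₀ = 3.65, bare ≈ 20 eV, Im U peaks at 9, 13,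
21 and a broad one at 30 eV, Z_B = 0.58)] `[float]` CONSISTENCY of the printed round numbers with
the enclosure of §2: with `ΔU = 20 − 3.65 = 16.35` and the modes inside `[9, 30] eV`,
`exp(−16.35/(2·9)) ≤ 0.58 ≤ exp(−16.35/(2·30))` (shown via `1 + x ≤ eˣ`: the bounds are
`≤ 1/1.908… < 0.53` and `≥ 0.7275`). -/
theorem la2CuO4_oneBand_zB_enclosure_float :
    zBStatic (20 - 3.65) 9 ≤ 0.58 ∧ (0.58 : ℝ) ≤ zBStatic (20 - 3.65) 30 := by
  unfold zBStatic
  constructor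
  · rw [Real.exp_neg]
    have h1 : (20 - 3.65) / (2 * 9) + 1 ≤ Real.exp ((20 - 3.65) / (2 * 9) : ℝ) :=
      Real.add_one_le_exp _
    have h0 : (0 : ℝ) < (20 - 3.65) / (2 * 9) + 1 := by norm_num
    calc (Real.exp ((20 - 3.65) / (2 * 9) : ℝ))⁻¹ ≤ ((20 - 3.65) / (2 * 9) + 1 : ℝ)⁻¹ :=
          inv_anti₀ h0 h1
      _ ≤ 0.58 := by norm_num
  · have h1 : -((20 - 3.65) / (2 * 30) : ℝ) + 1 ≤ Real.exp (-((20 - 3.65) / (2 * 30) : ℝ)) :=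
      Real.add_one_le_exp _
    have h2 : (0.58 : ℝ) ≤ -((20 - 3.65) / (2 * 30) : ℝ) + 1 := by norm_num
    exact le_trans h2 h1

/-! ## 4. The `dp` form (Eq. (7)) under Löwdin elimination of the `p` block -/

section DP

open Matrix

variable {K : Type*} [CommRing K] {m n : Type*}

/-- Casula et al.'s renormalised one-body HOPPING matrix of a `dp` model, Eq. (7), in block form
with the `d` block first: `fromBlocks (Z•T_dd) (s•T_dp) (s•T_pd) T_pp` with `Z = s·s`
(`s = √Z_B`; every `d` operator carries `√Z_B`, `p` operators none). On-site (density) terms are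
not renormalised by the Lang–Firsov shift and are kept OUT of `T_dd` (see `loewdinHam_renormHop`).
[cite: CasulaEtAl2012, Eq. (7)] -/
def renormHop (s : K) (Tdd : Matrix m m K) (Tdp : Matrix m n K) (Tpd : Matrix n m K)
    (Tpp : Matrix n n K) : Matrix (m ⊕ n) (m ⊕ n) K :=
  Matrix.fromBlocks ((s * s) • Tdd) (s • Tdp) (s • Tpd) Tpp

/-- [cite: CasulaEtAl2012, Eq. (7)] Unfolding lemma. -/
theorem renormHop_def (s : K) (Tdd : Matrix m m K) (Tdp : Matrix m n K) (Tpd : Matrix n m K)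
    (Tpp : Matrix n n K) :
    renormHop s Tdd Tdp Tpd Tpp = Matrix.fromBlocks ((s * s) • Tdd) (s • Tdp) (s • Tpd) Tpp :=
  rfl

/-- [cite: CasulaEtAl2012, Eq. (7)] `s = 1` (no screening modes) is the bare hopping matrix. -/
theorem renormHop_one (Tdd : Matrix m m K) (Tdp : Matrix m n K) (Tpd : Matrix n m K)
    (Tpp : Matrix n n K) : renormHop 1 Tdd Tdp Tpd Tpp = Matrix.fromBlocks Tdd Tdp Tpd Tpp := by
  simp [renormHop]

/-- [cite: CasulaEtAl2012, Eq. (7)] The renormalisation preserves (transpose-)symmetry of the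
hopping matrix: if `T_ddᵀ = T_dd`, `T_ppᵀ = T_pp`, `T_dpᵀ = T_pd` then the renormalised matrix is
symmetric. -/
theorem renormHop_transpose (s : K) {Tdd : Matrix m m K} {Tdp : Matrix m n K} {Tpd : Matrix n m K}
    {Tpp : Matrix n n K} (hdd : Tddᵀ = Tdd) (hpp : Tppᵀ = Tpp) (hdp : Tdpᵀ = Tpd) :
    (renormHop s Tdd Tdp Tpd Tpp)ᵀ = renormHop s Tdd Tdp Tpd Tpp := by
  have hpd : Tpdᵀ = Tdp := by rw [← hdp, transpose_transpose]
  unfold renormHop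
  rw [Matrix.fromBlocks_transpose]
  simp [transpose_smul, hdd, hpp, hdp, hpd]

/-- **Eq. (7) meets Löwdin** [cite: CasulaEtAl2012, Eq. (7)]: eliminating the `p` block at energy
`ω` from the renormalised `dp` one-body matrix whose `d` block is `ε_d•1 + Z•T_dd` (unrenormalised
level + renormalised `d–d` hopping) gives `ε_d•1 + Z•H_eff^bare(ω)` where
`H_eff^bare(ω) = T_dd + T_dp (ω − T_pp)⁻¹ T_pd` is the bare downfolded operator measured from the
`d` level: the `p`-mediated paths acquire `s·s = Z` exactly like the direct ones, so at fixed `ω`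
the one-band operator is UNIFORMLY scaled by `Z_B` (cf. `loewdinHam`, [BognerKuoSchwenk2003]). -/
theorem loewdinHam_renormHop [Fintype n] [DecidableEq n] [DecidableEq m] (εd s ω : K) (Tdd : Matrix m m K)
    (Tdp : Matrix m n K) (Tpd : Matrix n m K) (Tpp : Matrix n n K) :
    loewdinHam (εd • (1 : Matrix m m K) + (s * s) • Tdd) (s • Tdp) (s • Tpd) Tpp ω =
      εd • (1 : Matrix m m K) + (s * s) • loewdinHam Tdd Tdp Tpd Tpp ω := by
  simp only [loewdinHam_def, Matrix.smul_mul, Matrix.mul_smul, smul_smul, smul_add, add_assoc]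

/-- [cite: CasulaEtAl2012, Eq. (7)] The same with no separate level (`ε_d = 0`):
`H_eff^ren(ω) = Z • H_eff^bare(ω)`. -/
theorem loewdinHam_renormHop_zero [Fintype n] [DecidableEq n] [DecidableEq m] (s ω : K) (Tdd : Matrix m m K)
    (Tdp : Matrix m n K) (Tpd : Matrix n m K) (Tpp : Matrix n n K) :
    loewdinHam ((s * s) • Tdd) (s • Tdp) (s • Tpd) Tpp ω =
      (s * s) • loewdinHam Tdd Tdp Tpd Tpp ω := by
  have h := loewdinHam_renormHop (0 : K) s ω Tdd Tdp Tpd Tpp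
  simpa using h

/-- [cite: CasulaEtAl2012, Eq. (7)] The blocks of `renormHop` are the ones fed to `loewdinHam`
above: `toBlocks₁₁ = Z•T_dd`, `toBlocks₁₂ = s•T_dp`, `toBlocks₂₁ = s•T_pd`, `toBlocks₂₂ = T_pp`. -/
theorem renormHop_toBlocks (s : K) (Tdd : Matrix m m K) (Tdp : Matrix m n K) (Tpd : Matrix n m K)
    (Tpp : Matrix n n K) :
    (renormHop s Tdd Tdp Tpd Tpp).toBlocks₁₁ = (s * s) • Tdd ∧
      (renormHop s Tdd Tdp Tpd Tpp).toBlocks₁₂ = s • Tdp ∧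
      (renormHop s Tdd Tdp Tpd Tpp).toBlocks₂₁ = s • Tpd ∧
      (renormHop s Tdd Tdp Tpd Tpp).toBlocks₂₂ = Tpp := by
  unfold renormHop
  simp

end DP

/-! ## 5. The continuum form of Eqs. (8)–(10): `Im U` supported on `[a, b] ⊂ (0, ∞)` -/

section Continuum

open MeasureTheory intervalIntegral Set

/-- Continuum static reduction for a retarded `Im U ≤ 0` supported in `[a, b]`:
`ΔU = V − U₀ = −(2/π) ∫_a^b Im U(ν)/ν dν`. [cite: CasulaEtAl2012, Eq. (8)] -/
def deltaUCont (f : ℝ → ℝ) (a b : ℝ) : ℝ := -(2 / Real.pi) * ∫ ν in a..b, f ν / ν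

/-- Continuum boson weight `−log Z_B = −(1/π) ∫_a^b Im U(ν)/ν² dν`. [cite: CasulaEtAl2012, Eq. (9)] -/
def bosonWeightCont (f : ℝ → ℝ) (a b : ℝ) : ℝ := -(1 / Real.pi) * ∫ ν in a..b, f ν / ν ^ 2

/-- `Z_B = exp((1/π) ∫_a^b Im U(ν)/ν² dν)`. [cite: CasulaEtAl2012, Eq. (9)] -/
def zBCont (f : ℝ → ℝ) (a b : ℝ) : ℝ := Real.exp (-(bosonWeightCont f a b))

/-- The characteristic frequency `ω₀ = ∫ ν·Im U/ν² / ∫ Im U/ν² = (∫ Im U/ν)/(∫ Im U/ν²)`.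
[cite: CasulaEtAl2012, Eq. (10)] -/
def omegaCharCont (f : ℝ → ℝ) (a b : ℝ) : ℝ :=
  (∫ ν in a..b, f ν / ν) / ∫ ν in a..b, f ν / ν ^ 2

/-- [cite: CasulaEtAl2012, Eq. (8)] Unfolding lemma. -/
theorem deltaUCont_def (f : ℝ → ℝ) (a b : ℝ) :
    deltaUCont f a b = -(2 / Real.pi) * ∫ ν in a..b, f ν / ν := rfl

/-- [cite: CasulaEtAl2012, Eq. (9)] Unfolding lemma. -/
theorem bosonWeightCont_def (f : ℝ → ℝ) (a b : ℝ) :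
    bosonWeightCont f a b = -(1 / Real.pi) * ∫ ν in a..b, f ν / ν ^ 2 := rfl

/-- [cite: CasulaEtAl2012, Eq. (9)] Unfolding lemma. -/
theorem zBCont_def (f : ℝ → ℝ) (a b : ℝ) :
    zBCont f a b = Real.exp (-(bosonWeightCont f a b)) := rfl

/-- [cite: CasulaEtAl2012, Eq. (10)] Unfolding lemma. -/
theorem omegaCharCont_def (f : ℝ → ℝ) (a b : ℝ) :
    omegaCharCont f a b = (∫ ν in a..b, f ν / ν) / ∫ ν in a..b, f ν / ν ^ 2 := rfl

/-- [cite: CasulaEtAl2012, Eq. (9)] `Z_B > 0`. -/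
theorem zBCont_pos (f : ℝ → ℝ) (a b : ℝ) : 0 < zBCont f a b := Real.exp_pos _

/-- **Matching identity, continuum form** [cite: CasulaEtAl2012, Eqs. (8)–(10)]: with `ω₀` the
characteristic frequency of Eq. (10), `Z_B = exp(−ΔU/(2ω₀))` EXACTLY (both integrals non-zero). -/
theorem zBCont_eq_zBStatic (f : ℝ → ℝ) (a b : ℝ) (h1 : ∫ ν in a..b, f ν / ν ≠ 0)
    (h2 : ∫ ν in a..b, f ν / ν ^ 2 ≠ 0) :
    zBCont f a b = zBStatic (deltaUCont f a b) (omegaCharCont f a b) := by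
  unfold zBCont zBStatic deltaUCont omegaCharCont bosonWeightCont
  congr 1
  have hπ : Real.pi ≠ 0 := Real.pi_ne_zero
  field_simp

/-- Integrability of `Im U(ν)/ν` on `[a, b] ⊂ (0, ∞)` from that of `Im U`. [folklore] -/
private theorem intervalIntegrable_div_id {f : ℝ → ℝ} {a b : ℝ}
    (hf : IntervalIntegrable f volume a b) (ha : 0 < a) (hb : 0 < b) :
    IntervalIntegrable (fun ν => f ν / ν) volume a b := by
  have hcont : ContinuousOn (fun ν : ℝ => ν⁻¹) (uIcc a b) := by
    apply ContinuousOn.inv₀ continuousOn_id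
    intro x hx
    exact ne_of_gt (lt_of_lt_of_le (lt_min ha hb) hx.1)
  simpa [div_eq_mul_inv] using hf.mul_continuousOn hcont

/-- Integrability of `Im U(ν)/ν²` on `[a, b] ⊂ (0, ∞)` from that of `Im U`. [folklore] -/
private theorem intervalIntegrable_div_sq {f : ℝ → ℝ} {a b : ℝ}
    (hf : IntervalIntegrable f volume a b) (ha : 0 < a) (hb : 0 < b) :
    IntervalIntegrable (fun ν => f ν / ν ^ 2) volume a b := by
  have hcont : ContinuousOn (fun ν : ℝ => (ν ^ 2)⁻¹) (uIcc a b) := by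
    apply ContinuousOn.inv₀ (continuousOn_id.pow 2)
    intro x hx
    exact pow_ne_zero 2 (ne_of_gt (lt_of_lt_of_le (lt_min ha hb) hx.1))
  simpa [div_eq_mul_inv] using hf.mul_continuousOn hcont

/-- [cite: CasulaEtAl2012, Eqs. (8)–(9)] Pointwise comparison behind the enclosure, integrated:
`(∫ Im U/ν)/a ≤ ∫ Im U/ν²` on `[a, b]`, `0 < a ≤ b`, `Im U ≤ 0`. -/
theorem integral_div_le_integral_div_sq {f : ℝ → ℝ} {a b : ℝ} (hab : a ≤ b) (ha : 0 < a)
    (hf : IntervalIntegrable f volume a b) (hneg : ∀ ν ∈ Icc a b, f ν ≤ 0) :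
    (∫ ν in a..b, f ν / ν) / a ≤ ∫ ν in a..b, f ν / ν ^ 2 := by
  have hb : 0 < b := lt_of_lt_of_le ha hab
  have hI1 := intervalIntegrable_div_id hf ha hb
  have hI2 := intervalIntegrable_div_sq hf ha hb
  rw [div_eq_mul_inv, ← intervalIntegral.integral_mul_const]
  refine intervalIntegral.integral_mono_on hab (hI1.mul_const _) hI2 fun x hx => ?_
  have hx0 : 0 < x := lt_of_lt_of_le ha hx.1
  have hfx : f x ≤ 0 := hneg x hx
  have h1 : 1 / x ^ 2 ≤ 1 / (x * a) := by
    apply one_div_le_one_div_of_le (by positivity)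
    calc x * a ≤ x * x := mul_le_mul_of_nonneg_left hx.1 hx0.le
      _ = x ^ 2 := (sq x).symm
  calc f x / x * a⁻¹ = f x * (1 / (x * a)) := by field_simp
    _ ≤ f x * (1 / x ^ 2) := mul_le_mul_of_nonpos_left h1 hfx
    _ = f x / x ^ 2 := by field_simp

/-- [cite: CasulaEtAl2012, Eqs. (8)–(9)] … and `∫ Im U/ν² ≤ (∫ Im U/ν)/b`. -/
theorem integral_div_sq_le_integral_div {f : ℝ → ℝ} {a b : ℝ} (hab : a ≤ b) (ha : 0 < a)
    (hf : IntervalIntegrable f volume a b) (hneg : ∀ ν ∈ Icc a b, f ν ≤ 0) :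
    (∫ ν in a..b, f ν / ν ^ 2) ≤ (∫ ν in a..b, f ν / ν) / b := by
  have hb : 0 < b := lt_of_lt_of_le ha hab
  have hI1 := intervalIntegrable_div_id hf ha hb
  have hI2 := intervalIntegrable_div_sq hf ha hb
  rw [div_eq_mul_inv, ← intervalIntegral.integral_mul_const]
  refine intervalIntegral.integral_mono_on hab hI2 (hI1.mul_const _) fun x hx => ?_
  have hx0 : 0 < x := lt_of_lt_of_le ha hx.1
  have hfx : f x ≤ 0 := hneg x hx
  have h1 : 1 / (x * b) ≤ 1 / x ^ 2 := by
    apply one_div_le_one_div_of_le (by positivity)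
    calc x ^ 2 = x * x := sq x
      _ ≤ x * b := mul_le_mul_of_nonneg_left hx.2 hx0.le
  calc f x / x ^ 2 = f x * (1 / x ^ 2) := by field_simp
    _ ≤ f x * (1 / (x * b)) := mul_le_mul_of_nonpos_left h1 hfx
    _ = f x / x * b⁻¹ := by field_simp

/-- [cite: CasulaEtAl2012, Eq. (8)] `ΔU ≥ 0` for a retarded (`Im U ≤ 0`) spectral function on
`[a, b] ⊂ (0, ∞)`. -/
theorem deltaUCont_nonneg {f : ℝ → ℝ} {a b : ℝ} (hab : a ≤ b) (ha : 0 < a)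
    (hf : IntervalIntegrable f volume a b) (hneg : ∀ ν ∈ Icc a b, f ν ≤ 0) :
    0 ≤ deltaUCont f a b := by
  have hb : 0 < b := lt_of_lt_of_le ha hab
  have hI1 := intervalIntegrable_div_id hf ha hb
  have hle : (∫ ν in a..b, f ν / ν) ≤ ∫ _ν in a..b, (0 : ℝ) := by
    refine intervalIntegral.integral_mono_on hab hI1 intervalIntegrable_const fun x hx => ?_
    have hx0 : 0 < x := lt_of_lt_of_le ha hx.1
    exact div_nonpos_of_nonpos_of_nonneg (hneg x hx) hx0.le
  rw [intervalIntegral.integral_const, smul_zero] at hle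
  unfold deltaUCont
  have hπ : 0 < Real.pi := Real.pi_pos
  have : 0 ≤ -(2 / Real.pi) * ∫ ν in a..b, f ν / ν := by
    rw [neg_mul, neg_nonneg]
    exact mul_nonpos_of_nonneg_of_nonpos (by positivity) hle
  exact this

/-- [cite: CasulaEtAl2012, Eqs. (8)–(9)] Upper bound on the boson weight from the LOWER edge of
the support: `−log Z_B ≤ ΔU/(2a)`. -/
theorem bosonWeightCont_le {f : ℝ → ℝ} {a b : ℝ} (hab : a ≤ b) (ha : 0 < a)
    (hf : IntervalIntegrable f volume a b) (hneg : ∀ ν ∈ Icc a b, f ν ≤ 0) :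
    bosonWeightCont f a b ≤ deltaUCont f a b / (2 * a) := by
  have key := integral_div_le_integral_div_sq hab ha hf hneg
  unfold bosonWeightCont deltaUCont
  have hπ : 0 < Real.pi := Real.pi_pos
  rw [show -(2 / Real.pi) * (∫ ν in a..b, f ν / ν) / (2 * a)
      = -((1 / Real.pi) * ((∫ ν in a..b, f ν / ν) / a)) by field_simp]
  have : (1 / Real.pi) * ((∫ ν in a..b, f ν / ν) / a)
      ≤ (1 / Real.pi) * ∫ ν in a..b, f ν / ν ^ 2 :=
    mul_le_mul_of_nonneg_left key (by positivity)
  linarith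

/-- [cite: CasulaEtAl2012, Eqs. (8)–(9)] Lower bound on the boson weight from the UPPER edge of
the support: `ΔU/(2b) ≤ −log Z_B`. -/
theorem le_bosonWeightCont {f : ℝ → ℝ} {a b : ℝ} (hab : a ≤ b) (ha : 0 < a)
    (hf : IntervalIntegrable f volume a b) (hneg : ∀ ν ∈ Icc a b, f ν ≤ 0) :
    deltaUCont f a b / (2 * b) ≤ bosonWeightCont f a b := by
  have hb : 0 < b := lt_of_lt_of_le ha hab
  have key := integral_div_sq_le_integral_div hab ha hf hneg
  unfold bosonWeightCont deltaUCont
  have hπ : 0 < Real.pi := Real.pi_pos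
  rw [show -(2 / Real.pi) * (∫ ν in a..b, f ν / ν) / (2 * b)
      = -((1 / Real.pi) * ((∫ ν in a..b, f ν / ν) / b)) by field_simp]
  have : (1 / Real.pi) * (∫ ν in a..b, f ν / ν ^ 2)
      ≤ (1 / Real.pi) * ((∫ ν in a..b, f ν / ν) / b) :=
    mul_le_mul_of_nonneg_left key (by positivity)
  linarith

/-- **Two-sided enclosure, continuum form** [cite: CasulaEtAl2012, Eqs. (8)–(10)]: for a retarded
`Im U ≤ 0` supported in `[a, b] ⊂ (0, ∞)`,
`exp(−ΔU/(2a)) ≤ Z_B ≤ exp(−ΔU/(2b))`. -/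
theorem zBCont_mem_Icc {f : ℝ → ℝ} {a b : ℝ} (hab : a ≤ b) (ha : 0 < a)
    (hf : IntervalIntegrable f volume a b) (hneg : ∀ ν ∈ Icc a b, f ν ≤ 0) :
    zBStatic (deltaUCont f a b) a ≤ zBCont f a b ∧
      zBCont f a b ≤ zBStatic (deltaUCont f a b) b := by
  unfold zBStatic zBCont
  constructor
  · apply Real.exp_le_exp.mpr
    have := bosonWeightCont_le hab ha hf hneg
    linarith
  · apply Real.exp_le_exp.mpr
    have := le_bosonWeightCont hab ha hf hneg
    linarith

/-- [cite: CasulaEtAl2012, Eq. (10)] The characteristic frequency of a strictly screening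
(`∫ Im U/ν² < 0`) retarded spectral function supported in `[a, b] ⊂ (0, ∞)` lies in `[a, b]`. -/
theorem omegaCharCont_mem_Icc {f : ℝ → ℝ} {a b : ℝ} (hab : a ≤ b) (ha : 0 < a)
    (hf : IntervalIntegrable f volume a b) (hneg : ∀ ν ∈ Icc a b, f ν ≤ 0)
    (hI2 : ∫ ν in a..b, f ν / ν ^ 2 < 0) :
    a ≤ omegaCharCont f a b ∧ omegaCharCont f a b ≤ b := by
  have hb : 0 < b := lt_of_lt_of_le ha hab
  have k1 := integral_div_le_integral_div_sq hab ha hf hneg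
  have k2 := integral_div_sq_le_integral_div hab ha hf hneg
  unfold omegaCharCont
  set I1 := ∫ ν in a..b, f ν / ν with hI1def
  set I2 := ∫ ν in a..b, f ν / ν ^ 2 with hI2def
  constructor
  · -- from I1/a ≤ I2 < 0:  a ≤ I1/I2
    rw [le_div_iff_of_neg hI2]
    -- goal: I1 ≤ a * I2  (direction flips)
    have := (div_le_iff₀ ha).mp k1
    linarith
  · rw [div_le_iff_of_neg hI2]
    -- goal: b * I2 ≤ I1
    have := (le_div_iff₀ hb).mp k2
    linarith

end Continuum

/-! ## 6. The single-pole MATSUBARA form of `U(iν)` (the (K) dataset's Holstein parametrisation)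

Vučičević–Kumar–Yeh–Morales–Rösner fit the cRPA on-site interaction on the bosonic Matsubara axis
by ONE real-axis pole, `U(iν) ≈ V + A (1/(iν − E) − 1/(iν + E))`, and read off an effective
Hubbard/Emery–Holstein model with boson frequency `ω = E` and coupling `g = √A`
[VucicevicEtAl2026, §VII.D, Eq. (5)] — i.e. exactly the one-mode object of §1 with `λ = g`,
`ω₀ = E`: the pole pair evaluates to the REAL number `−2AE/(ν² + E²)` (`polePair_eq`), so
`U(iν) = V − 2g²E/(ν² + E²)` (`matsubaraU`), whose static value is `screenedU V g E` and whose
boson factor is `zB g E`.  What the cell uses: `U(iν)` is even, increases with `ν²` from `U₀`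
towards `V` (why the tabulated `U(iν = 5 eV)` exceeds `U(0)`), and `(V − U(iν))·(ν² + E²) = 2g²E`
is `ν`-independent (two Matsubara values determine `E`).  Nothing here asserts that a one-pole
fit is ACCURATE for a given material (REFVALS-1 §F7 records that it under-carries the
low-frequency screening); only the algebra of the printed parametrisation is typed. -/

section SinglePole

/-- The one-pole Matsubara-axis interaction `U(iν) = V − 2g²E/(ν² + E²)`
[cite: VucicevicEtAl2026, Eq. (5)] (`A = g²`, `ω = E`). -/
def matsubaraU (V g E ν : ℝ) : ℝ := V - 2 * g ^ 2 * E / (ν ^ 2 + E ^ 2)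

/-- [cite: VucicevicEtAl2026, Eq. (5)] -/
theorem matsubaraU_def (V g E ν : ℝ) :
    matsubaraU V g E ν = V - 2 * g ^ 2 * E / (ν ^ 2 + E ^ 2) := rfl

/-- [cite: VucicevicEtAl2026, Eq. (5)] The pole pair of Eq. (5) on the Matsubara axis is real:
`A (1/(iν − E) − 1/(iν + E)) = −2AE/(ν² + E²)` whenever `ν² + E² ≠ 0`. -/
theorem polePair_eq (A E ν : ℝ) (h : ν ^ 2 + E ^ 2 ≠ 0) :
    (A : ℂ) * (1 / (Complex.I * ν - E) - 1 / (Complex.I * ν + E))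
      = ((-(2 * A * E / (ν ^ 2 + E ^ 2)) : ℝ) : ℂ) := by
  have hm : (Complex.I * ν - E) ≠ 0 := by
    intro hz
    apply h
    have hre := congrArg Complex.re hz
    have him := congrArg Complex.im hz
    simp at hre him
    subst hre; subst him; simp
  have hp : (Complex.I * ν + E) ≠ 0 := by
    intro hz
    apply h
    have hre := congrArg Complex.re hz
    have him := congrArg Complex.im hz
    simp at hre him
    subst hre
    have hν : ν = 0 := by linarith
    subst hν; simp
  have hc : ((ν : ℂ) ^ 2 + (E : ℂ) ^ 2) ≠ 0 := by exact_mod_cast h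
  have hprod : (Complex.I * ν - E) * (Complex.I * ν + E) = -((ν : ℂ) ^ 2 + (E : ℂ) ^ 2) := by
    ring_nf; rw [Complex.I_sq]; ring
  rw [div_sub_div _ _ hm hp, hprod]
  push_cast
  field_simp
  ring

/-- [cite: VucicevicEtAl2026, Eq. (5)] Eq. (5) evaluated: `V + A(1/(iν − E) − 1/(iν + E))`
is the real number `matsubaraU V g E ν` with `A = g²`. -/
theorem eq5_eq_matsubaraU (V g E ν : ℝ) (h : ν ^ 2 + E ^ 2 ≠ 0) :
    (V : ℂ) + (g ^ 2 : ℝ) * (1 / (Complex.I * ν - E) - 1 / (Complex.I * ν + E))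
      = ((matsubaraU V g E ν : ℝ) : ℂ) := by
  rw [polePair_eq _ _ _ h, matsubaraU_def]
  push_cast
  ring

/-- [cite: VucicevicEtAl2026, Eq. (5)] [cite: CasulaEtAl2012, Eq. (3)] The static value of the
one-pole form is Casula's screened `U₀ = V − 2g²/E`. -/
theorem matsubaraU_zero (V g : ℝ) {E : ℝ} (hE : E ≠ 0) :
    matsubaraU V g E 0 = screenedU V g E := by
  unfold matsubaraU screenedU
  field_simp
  ring

/-- [cite: VucicevicEtAl2026, Eq. (5)] `U(iν)` is even in `ν`. -/
theorem matsubaraU_neg (V g E ν : ℝ) : matsubaraU V g E (-ν) = matsubaraU V g E ν := by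
  unfold matsubaraU; ring_nf

/-- [cite: VucicevicEtAl2026, Eq. (5)] The screening carried at Matsubara frequency `ν`:
`V − U(iν) = 2g²E/(ν² + E²)`. -/
theorem sub_matsubaraU (V g E ν : ℝ) :
    V - matsubaraU V g E ν = 2 * g ^ 2 * E / (ν ^ 2 + E ^ 2) := by
  unfold matsubaraU; ring

/-- [cite: VucicevicEtAl2026, Eq. (5)] For `E > 0` the one-pole `U(iν)` never exceeds the bare `V`. -/
theorem matsubaraU_le (V g : ℝ) {E : ℝ} (hE : 0 < E) (ν : ℝ) : matsubaraU V g E ν ≤ V := by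
  rw [← sub_nonneg, sub_matsubaraU]
  positivity

/-- [cite: VucicevicEtAl2026, Eq. (5)] For `E > 0` the one-pole `U(iν)` is bounded below by its
static value `U₀ = screenedU V g E` (the tabulated `U(iν = 5 eV) ≥ U(0)`). -/
theorem screenedU_le_matsubaraU (V g : ℝ) {E : ℝ} (hE : 0 < E) (ν : ℝ) :
    screenedU V g E ≤ matsubaraU V g E ν := by
  rw [← matsubaraU_zero V g hE.ne', ← sub_nonneg]
  rw [show matsubaraU V g E ν - matsubaraU V g E 0
      = (V - matsubaraU V g E 0) - (V - matsubaraU V g E ν) by ring,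
    sub_matsubaraU, sub_matsubaraU, sub_nonneg]
  have hE2 : 0 < E ^ 2 := by positivity
  apply div_le_div_of_nonneg_left (by positivity) (by positivity)
  nlinarith [sq_nonneg ν]

/-- [cite: VucicevicEtAl2026, Eq. (5)] Monotonicity in `ν²` for `E > 0`: the one-pole interaction
rises along the Matsubara axis towards `V`. -/
theorem matsubaraU_mono_sq (V g : ℝ) {E : ℝ} (hE : 0 < E) {ν₁ ν₂ : ℝ} (h : ν₁ ^ 2 ≤ ν₂ ^ 2) :
    matsubaraU V g E ν₁ ≤ matsubaraU V g E ν₂ := by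
  rw [← sub_nonneg,
    show matsubaraU V g E ν₂ - matsubaraU V g E ν₁
      = (V - matsubaraU V g E ν₁) - (V - matsubaraU V g E ν₂) by ring,
    sub_matsubaraU, sub_matsubaraU, sub_nonneg]
  have hE2 : 0 < E ^ 2 := by positivity
  exact div_le_div_of_nonneg_left (by positivity) (by positivity) (by linarith)

/-- [cite: VucicevicEtAl2026, Eq. (5)] The `ν`-independent invariant of the one-pole form:
`(V − U(iν))·(ν² + E²) = 2g²E` — two Matsubara values determine the pole (for `ν² + E² ≠ 0`). -/
theorem sub_matsubaraU_mul (V g E ν : ℝ) (h : ν ^ 2 + E ^ 2 ≠ 0) :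
    (V - matsubaraU V g E ν) * (ν ^ 2 + E ^ 2) = 2 * g ^ 2 * E := by
  rw [sub_matsubaraU, div_mul_cancel₀ _ h]

/-- [cite: VucicevicEtAl2026, Eq. (5)] [cite: CasulaEtAl2012, Eq. (4)] The boson factor of the
fitted model is §1's `zB g E`, and by the matching identity it is fixed by the STATIC reduction of
the one-pole form and the pole: `Z_B = exp(−(V − U(i0))/(2E))`. -/
theorem zB_eq_zBStatic_matsubaraU (V g : ℝ) {E : ℝ} (hE : E ≠ 0) :
    zB g E = zBStatic (V - matsubaraU V g E 0) E := by
  rw [matsubaraU_zero V g hE]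
  exact zB_eq_zBStatic V g hE

end SinglePole

/-! ### 6b. Two Matsubara values determine the pole (the table-consistent one-pole)

For the one-pole form the screening ratios at two Matsubara frequencies fix `E²` in closed form:
with `Δ(ν) := V − U(iν) = 2g²E/(ν² + E²)` one has `Δ(0)·E² = Δ(ν)·(ν² + E²)`, i.e.
`E² = ν² Δ(ν)/(Δ(0) − Δ(ν))` whenever `Δ(0) ≠ Δ(ν)` — the inversion by which a table printing
`V`, `U(0)` and `U(iν₀)` (the (K) set: `ν₀ = 5 eV`) carries its OWN one-pole, distinct from a
tail fit [VucicevicEtAl2026, Eq. (5)]; the boson factor then follows from §1's matching identity. -/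

/-- [cite: VucicevicEtAl2026, Eq. (5)] Static vs finite-frequency screening of the one-pole form:
`(V − U(i0))·E² = (V − U(iν))·(ν² + E²)` (both equal `2g²E`), for `E ≠ 0`. -/
theorem sub_matsubaraU_zero_mul_sq (V g : ℝ) {E : ℝ} (hE : E ≠ 0) (ν : ℝ) :
    (V - matsubaraU V g E 0) * E ^ 2 = (V - matsubaraU V g E ν) * (ν ^ 2 + E ^ 2) := by
  have h0 : (0 : ℝ) ^ 2 + E ^ 2 ≠ 0 := by positivity
  have hν : ν ^ 2 + E ^ 2 ≠ 0 := by positivity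
  rw [sub_matsubaraU_mul V g E ν hν, ← sub_matsubaraU_mul V g E 0 h0]
  ring

/-- [cite: VucicevicEtAl2026, Eq. (5)] **Two-point inversion.** If the static and the
finite-frequency screenings of the one-pole form differ, the pole is
`E² = ν²·(V − U(iν)) / ((V − U(i0)) − (V − U(iν)))`. -/
theorem poleSq_eq_of_two_values (V g : ℝ) {E : ℝ} (hE : E ≠ 0) (ν : ℝ)
    (hΔ : (V - matsubaraU V g E 0) - (V - matsubaraU V g E ν) ≠ 0) :
    E ^ 2 = ν ^ 2 * (V - matsubaraU V g E ν)
      / ((V - matsubaraU V g E 0) - (V - matsubaraU V g E ν)) := by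
  rw [eq_div_iff hΔ]
  have key := sub_matsubaraU_zero_mul_sq V g hE ν
  -- key : Δ0·E² = Δν·(ν² + E²)
  linear_combination key

/-- [cite: VucicevicEtAl2026, Eq. (5)] For `E > 0`, `g ≠ 0` and `ν ≠ 0` the two screenings DO
differ (the static one is strictly larger), so the inversion above applies. -/
theorem sub_matsubaraU_zero_gt (V : ℝ) {g E ν : ℝ} (hg : g ≠ 0) (hE : 0 < E) (hν : ν ≠ 0) :
    V - matsubaraU V g E ν < V - matsubaraU V g E 0 := by
  rw [sub_matsubaraU, sub_matsubaraU]
  have hg2 : 0 < g ^ 2 := by positivity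
  have hν2 : 0 < ν ^ 2 := by positivity
  apply div_lt_div_of_pos_left (by positivity) (by positivity)
  nlinarith

/-- [cite: VucicevicEtAl2026, Eq. (5)] [cite: CasulaEtAl2012, Eq. (10)] The boson factor of the
table-consistent one-pole in terms of the STATIC screening and the pole only:
`Z_B = exp(−(V − U(i0))/(2E))` — §1's `zBStatic`, so the §1–§2 monotonicity / enclosure
statements apply to it verbatim. -/
theorem zB_twoPoint (V g : ℝ) {E : ℝ} (hE : E ≠ 0) :
    zB g E = Real.exp (-((V - matsubaraU V g E 0) / (2 * E))) := by
  rw [zB_eq_zBStatic_matsubaraU V g hE, zBStatic_def]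


/-! ## 6c. Two-point poles of a MULTI-mode `U(iν)` and a two-sided bound on `Z_B`

For finitely many modes `U(iν) = V − Σᵢ 2λᵢ²ωᵢ/(ν² + ωᵢ²)` (the Matsubara form of §2's mode
content) the one-pole «two-point» construction of §6b, `E(ν)² := ν²Δ(ν)/(Δ(0) − Δ(ν))` with
`Δ(ν) = V − U(iν)`, is a WEIGHTED MEAN of the `ωᵢ²` (weights `λᵢ²/(ωᵢ(ν² + ωᵢ²))`): at `ν → 0`
it is `E₀² = (Σλᵢ²/ωᵢ)/(Σλᵢ²/ωᵢ³)` (`lowPoleSq`), at `ν → ∞` (the `1/ν²` tail a one-pole TAIL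
fit matches) it is `E_∞² = (Σλᵢ²ωᵢ)/(Σλᵢ²/ωᵢ)` (`highPoleSq`).  By Cauchy–Schwarz
`E₀ ≤ ω̄ ≤ E_∞` where `ω̄` is Casula's characteristic frequency of §2 (`omegaChar`), and since
`Z_B = exp(−Δ(0)/(2ω̄))` EXACTLY (`zBModes_eq_zBStatic`) and `exp(−Δ/(2·))` is monotone,
**`exp(−Δ(0)/(2E₀)) ≤ Z_B ≤ exp(−Δ(0)/(2E_∞))`** (`zBModes_mem_Icc_twoPoint`): the static
screening together with the LOW-frequency curvature of `U(iν)` bounds `Z_B` from BELOW, together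
with the high-frequency tail from ABOVE — the theorem behind the per-compound bracket
`[Z_2pt, Z_fit]` read off the (K) table [VucicevicEtAl2026, Eq. (5); CasulaEtAl2012, Eq. (10)].
(At a FINITE `ν` the two-point pole lies between `E₀` and `E_∞` but on either side of `ω̄` in
general; only the two limits are one-sided bounds.) -/

section TwoPointBracket

variable {ι : Type*} [Fintype ι]

/-- Multi-mode Matsubara-axis interaction `U(iν) = V − Σᵢ 2λᵢ²ωᵢ/(ν² + ωᵢ²)` (sum of §6
one-pole terms). [cite: VucicevicEtAl2026, Eq. (5)] [cite: CasulaEtAl2012, Eq. (8)] -/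
def matsubaraUModes (V : ℝ) (lam ω : ι → ℝ) (ν : ℝ) : ℝ :=
  V - ∑ i, 2 * lam i ^ 2 * ω i / (ν ^ 2 + ω i ^ 2)

/-- The two-point pole (squared) of the multi-mode form at Matsubara frequency `ν`, written as
the weighted mean of the `ωᵢ²` it equals:
`E(ν)² = (Σ λᵢ²ωᵢ/(ν²+ωᵢ²)) / (Σ λᵢ²/(ωᵢ(ν²+ωᵢ²)))`. [cite: VucicevicEtAl2026, Eq. (5)] -/
def twoPointPoleSq (lam ω : ι → ℝ) (ν : ℝ) : ℝ :=
  (∑ i, lam i ^ 2 * ω i / (ν ^ 2 + ω i ^ 2)) / (∑ i, lam i ^ 2 / (ω i * (ν ^ 2 + ω i ^ 2)))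

/-- The `ν → 0` two-point pole squared, `E₀² = (Σλᵢ²/ωᵢ)/(Σλᵢ²/ωᵢ³)`.
[cite: CasulaEtAl2012, Eq. (10)] -/
def lowPoleSq (lam ω : ι → ℝ) : ℝ := (∑ i, lam i ^ 2 / ω i) / (∑ i, lam i ^ 2 / ω i ^ 3)

/-- The tail (`ν → ∞`) pole squared, `E_∞² = (Σλᵢ²ωᵢ)/(Σλᵢ²/ωᵢ)` — first over zeroth inverse
moment of `−Im U/π = Σλᵢ²δ(ν − ωᵢ)`, what a one-pole fit of the `1/ν²`–`1/ν⁴` tail returns.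
[cite: CasulaEtAl2012, Eq. (10)] -/
def highPoleSq (lam ω : ι → ℝ) : ℝ := (∑ i, lam i ^ 2 * ω i) / (∑ i, lam i ^ 2 / ω i)

/-- [cite: CasulaEtAl2012, Eq. (8)] Static value of the multi-mode form: `U(i0) = V − ΔU`. -/
theorem matsubaraUModes_zero (V : ℝ) (lam : ι → ℝ) {ω : ι → ℝ} (hω : ∀ i, ω i ≠ 0) :
    matsubaraUModes V lam ω 0 = V - deltaU lam ω := by
  unfold matsubaraUModes deltaU
  congr 1
  refine Finset.sum_congr rfl fun i _ => ?_
  have := hω i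
  field_simp
  ring

/-- [cite: VucicevicEtAl2026, Eq. (5)] Screening carried at `ν`: `V − U(iν) = Σ 2λᵢ²ωᵢ/(ν²+ωᵢ²)`. -/
theorem sub_matsubaraUModes (V : ℝ) (lam ω : ι → ℝ) (ν : ℝ) :
    V - matsubaraUModes V lam ω ν = ∑ i, 2 * lam i ^ 2 * ω i / (ν ^ 2 + ω i ^ 2) := by
  unfold matsubaraUModes; ring

/-- [cite: VucicevicEtAl2026, Eq. (5)] The static-minus-finite-frequency screening of the
multi-mode form: `Δ(0) − Δ(ν) = 2ν² Σ λᵢ²/(ωᵢ(ν²+ωᵢ²))` (`ωᵢ ≠ 0`). -/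
theorem deltaU_sub_sub_matsubaraUModes (V : ℝ) (lam : ι → ℝ) {ω : ι → ℝ} (hω : ∀ i, 0 < ω i)
    (ν : ℝ) :
    (V - matsubaraUModes V lam ω 0) - (V - matsubaraUModes V lam ω ν)
      = 2 * ν ^ 2 * ∑ i, lam i ^ 2 / (ω i * (ν ^ 2 + ω i ^ 2)) := by
  rw [matsubaraUModes_zero V lam (fun i => (hω i).ne'), sub_matsubaraUModes, deltaU,
    sub_sub_cancel, ← Finset.sum_sub_distrib, Finset.mul_sum]
  refine Finset.sum_congr rfl fun i _ => ?_
  have h1 : ω i ≠ 0 := (hω i).ne'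
  have h2 : ν ^ 2 + ω i ^ 2 ≠ 0 := by positivity
  field_simp
  ring

/-- **The two-point pole of §6b, evaluated on a multi-mode `U(iν)`** [cite: VucicevicEtAl2026,
Eq. (5)]: `E(ν)²·(Δ(0) − Δ(ν)) = ν²·Δ(ν)` with `E(ν)² = twoPointPoleSq` — i.e. whenever
`Δ(0) ≠ Δ(ν)` the §6b inversion applied to multi-mode data returns the weighted mean
`twoPointPoleSq`. -/
theorem twoPointPoleSq_mul (V : ℝ) (lam : ι → ℝ) {ω : ι → ℝ} (hω : ∀ i, 0 < ω i) (ν : ℝ)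
    (hD : ∑ i, lam i ^ 2 / (ω i * (ν ^ 2 + ω i ^ 2)) ≠ 0) :
    twoPointPoleSq lam ω ν * ((V - matsubaraUModes V lam ω 0) - (V - matsubaraUModes V lam ω ν))
      = ν ^ 2 * (V - matsubaraUModes V lam ω ν) := by
  rw [deltaU_sub_sub_matsubaraUModes V lam hω, sub_matsubaraUModes, twoPointPoleSq]
  rw [show (∑ i, 2 * lam i ^ 2 * ω i / (ν ^ 2 + ω i ^ 2))
      = 2 * ∑ i, lam i ^ 2 * ω i / (ν ^ 2 + ω i ^ 2) by
    rw [Finset.mul_sum]; refine Finset.sum_congr rfl fun i _ => ?_; ring]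
  field_simp

/-- [cite: CasulaEtAl2012, Eq. (10)] At `ν = 0` the two-point pole is `E₀² = lowPoleSq`. -/
theorem twoPointPoleSq_zero (lam : ι → ℝ) {ω : ι → ℝ} (hω : ∀ i, ω i ≠ 0) :
    twoPointPoleSq lam ω 0 = lowPoleSq lam ω := by
  unfold twoPointPoleSq lowPoleSq
  congr 1
  · refine Finset.sum_congr rfl fun i _ => ?_
    have := hω i
    field_simp
    ring
  · refine Finset.sum_congr rfl fun i _ => ?_
    have := hω i
    field_simp
    ring

/-! ### Positivity of the moments (some mode with `λᵢ ≠ 0`, all `ωᵢ > 0`) -/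

/-- [folklore] private positivity helper: `0 < Σ λᵢ²/ωᵢ` when all `ωᵢ > 0` and some `λᵢ ≠ 0`. -/
private theorem momA_pos (lam : ι → ℝ) {ω : ι → ℝ} (hω : ∀ i, 0 < ω i) (h : ∃ i, lam i ≠ 0) :
    0 < ∑ i, lam i ^ 2 / ω i := by
  obtain ⟨j, hj⟩ := h
  exact Finset.sum_pos' (fun i _ => by have := hω i; positivity)
    ⟨j, Finset.mem_univ _, by have := hω j; positivity⟩

/-- [folklore] private positivity helper: `0 < Σ λᵢ²/ωᵢ²` when all `ωᵢ > 0` and some `λᵢ ≠ 0`. -/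
private theorem momB_pos (lam : ι → ℝ) {ω : ι → ℝ} (hω : ∀ i, 0 < ω i) (h : ∃ i, lam i ≠ 0) :
    0 < bosonWeight lam ω := by
  obtain ⟨j, hj⟩ := h
  unfold bosonWeight
  exact Finset.sum_pos' (fun i _ => by have := hω i; positivity)
    ⟨j, Finset.mem_univ _, by have := hω j; positivity⟩

/-- [folklore] private positivity helper: `0 < Σ λᵢ²/ωᵢ³` when all `ωᵢ > 0` and some `λᵢ ≠ 0`. -/
private theorem momC_pos (lam : ι → ℝ) {ω : ι → ℝ} (hω : ∀ i, 0 < ω i) (h : ∃ i, lam i ≠ 0) :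
    0 < ∑ i, lam i ^ 2 / ω i ^ 3 := by
  obtain ⟨j, hj⟩ := h
  exact Finset.sum_pos' (fun i _ => by have := hω i; positivity)
    ⟨j, Finset.mem_univ _, by have := hω j; positivity⟩

/-- [folklore] private positivity helper: `0 < Σ λᵢ²ωᵢ` when all `ωᵢ > 0` and some `λᵢ ≠ 0`. -/
private theorem momD_pos (lam : ι → ℝ) {ω : ι → ℝ} (hω : ∀ i, 0 < ω i) (h : ∃ i, lam i ≠ 0) :
    0 < ∑ i, lam i ^ 2 * ω i := by
  obtain ⟨j, hj⟩ := h
  exact Finset.sum_pos' (fun i _ => by have := hω i; positivity)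
    ⟨j, Finset.mem_univ _, by have := hω j; positivity⟩

/-- [folklore] private positivity helper: `0 < Σ λᵢ²` when all `ωᵢ > 0` and some `λᵢ ≠ 0`. -/
private theorem momS_pos (lam : ι → ℝ) (h : ∃ i, lam i ≠ 0) : 0 < ∑ i, lam i ^ 2 := by
  obtain ⟨j, hj⟩ := h
  exact Finset.sum_pos' (fun i _ => sq_nonneg _) ⟨j, Finset.mem_univ _, by positivity⟩

/-! ### The three Cauchy–Schwarz instances -/

/-- [cite: CasulaEtAl2012, Eq. (10)] `(Σλ²/ω²)² ≤ (Σλ²/ω)(Σλ²/ω³)`. -/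
theorem bosonWeight_sq_le (lam : ι → ℝ) {ω : ι → ℝ} (hω : ∀ i, 0 < ω i) :
    bosonWeight lam ω ^ 2 ≤ (∑ i, lam i ^ 2 / ω i) * ∑ i, lam i ^ 2 / ω i ^ 3 := by
  unfold bosonWeight
  refine Finset.sum_sq_le_sum_mul_sum_of_sq_le_mul _ (fun i _ => ?_) (fun i _ => ?_)
    (fun i _ => ?_)
  · have := hω i; positivity
  · have := hω i; positivity
  · have := (hω i).ne'
    apply le_of_eq; field_simp

/-- [cite: CasulaEtAl2012, Eq. (10)] `(Σλ²/ω)² ≤ (Σλ²)(Σλ²/ω²)`. -/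
theorem momA_sq_le (lam : ι → ℝ) {ω : ι → ℝ} (hω : ∀ i, 0 < ω i) :
    (∑ i, lam i ^ 2 / ω i) ^ 2 ≤ (∑ i, lam i ^ 2) * bosonWeight lam ω := by
  unfold bosonWeight
  refine Finset.sum_sq_le_sum_mul_sum_of_sq_le_mul _ (fun i _ => sq_nonneg _) (fun i _ => ?_)
    (fun i _ => ?_)
  · have := hω i; positivity
  · have := (hω i).ne'
    apply le_of_eq; field_simp

/-- [cite: CasulaEtAl2012, Eq. (10)] `(Σλ²)² ≤ (Σλ²ω)(Σλ²/ω)`. -/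
theorem momS_sq_le (lam : ι → ℝ) {ω : ι → ℝ} (hω : ∀ i, 0 < ω i) :
    (∑ i, lam i ^ 2) ^ 2 ≤ (∑ i, lam i ^ 2 * ω i) * ∑ i, lam i ^ 2 / ω i := by
  refine Finset.sum_sq_le_sum_mul_sum_of_sq_le_mul _ (fun i _ => ?_) (fun i _ => ?_)
    (fun i _ => ?_)
  · have := hω i; positivity
  · have := hω i; positivity
  · have := (hω i).ne'
    apply le_of_eq; field_simp

/-! ### `E₀ ≤ ω̄ ≤ E_∞` and the `Z_B` bracket -/

/-- [cite: CasulaEtAl2012, Eq. (10)] **Low-frequency pole below the characteristic frequency**: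
`E₀² ≤ ω̄²`. -/
theorem lowPoleSq_le_omegaChar_sq (lam : ι → ℝ) {ω : ι → ℝ} (hω : ∀ i, 0 < ω i)
    (h : ∃ i, lam i ≠ 0) : lowPoleSq lam ω ≤ omegaChar lam ω ^ 2 := by
  have hA := momA_pos lam hω h
  have hB := momB_pos lam hω h
  have hC := momC_pos lam hω h
  have hCS := bosonWeight_sq_le lam hω
  unfold lowPoleSq omegaChar
  rw [div_pow, div_le_div_iff₀ hC (by positivity)]
  -- goal: A * B^2 ≤ A^2 * C
  nlinarith [mul_le_mul_of_nonneg_left hCS hA.le]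

/-- [cite: CasulaEtAl2012, Eq. (10)] **Tail pole above the characteristic frequency**:
`ω̄² ≤ E_∞²`. -/
theorem omegaChar_sq_le_highPoleSq (lam : ι → ℝ) {ω : ι → ℝ} (hω : ∀ i, 0 < ω i)
    (h : ∃ i, lam i ≠ 0) : omegaChar lam ω ^ 2 ≤ highPoleSq lam ω := by
  have hA := momA_pos lam hω h
  have hB := momB_pos lam hω h
  have hD := momD_pos lam hω h
  have hS := momS_pos lam h
  have h1 := momA_sq_le lam hω     -- A² ≤ S·B
  have h2 := momS_sq_le lam hω     -- S² ≤ D·A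
  unfold highPoleSq omegaChar
  rw [div_pow, div_le_div_iff₀ (by positivity) hA]
  -- goal: A^2 * A ≤ D * B^2 ; from A² ≤ S B and S² ≤ D A:  A⁴ ≤ S²B² ≤ D A B²
  set A := ∑ i, lam i ^ 2 / ω i
  set B := bosonWeight lam ω
  set D := ∑ i, lam i ^ 2 * ω i
  set S := ∑ i, lam i ^ 2
  have h3 : A ^ 2 * A ^ 2 ≤ (S * B) * (S * B) :=
    mul_le_mul h1 h1 (by positivity) (by positivity)
  have h4 : S ^ 2 * B ^ 2 ≤ D * A * B ^ 2 := mul_le_mul_of_nonneg_right h2 (by positivity)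
  nlinarith [h3, h4, hA, hB]

/-- [cite: CasulaEtAl2012, Eq. (10)] `E₀ ≤ ω̄` (square roots of the above; `ω̄ > 0`). -/
theorem sqrt_lowPoleSq_le_omegaChar (lam : ι → ℝ) {ω : ι → ℝ} (hω : ∀ i, 0 < ω i)
    (h : ∃ i, lam i ≠ 0) : Real.sqrt (lowPoleSq lam ω) ≤ omegaChar lam ω := by
  have hpos : 0 < omegaChar lam ω := by
    unfold omegaChar; exact div_pos (momA_pos lam hω h) (momB_pos lam hω h)
  rw [← Real.sqrt_sq hpos.le]
  exact Real.sqrt_le_sqrt (lowPoleSq_le_omegaChar_sq lam hω h)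

/-- [cite: CasulaEtAl2012, Eq. (10)] `ω̄ ≤ E_∞`. -/
theorem omegaChar_le_sqrt_highPoleSq (lam : ι → ℝ) {ω : ι → ℝ} (hω : ∀ i, 0 < ω i)
    (h : ∃ i, lam i ≠ 0) : omegaChar lam ω ≤ Real.sqrt (highPoleSq lam ω) := by
  have hpos : 0 < omegaChar lam ω := by
    unfold omegaChar; exact div_pos (momA_pos lam hω h) (momB_pos lam hω h)
  rw [← Real.sqrt_sq hpos.le]
  exact Real.sqrt_le_sqrt (omegaChar_sq_le_highPoleSq lam hω h)

/-- **Two-sided bound on `Z_B` from the two one-pole constructions** [cite: CasulaEtAl2012,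
Eq. (10)] [cite: VucicevicEtAl2026, Eq. (5)]: for any finite mode content (all `ωᵢ > 0`, some
`λᵢ ≠ 0`), `exp(−ΔU/(2E₀)) ≤ Z_B ≤ exp(−ΔU/(2E_∞))` — the static screening with the
LOW-frequency two-point pole bounds `Z_B` from below, with the TAIL pole from above. -/
theorem zBModes_mem_Icc_twoPoint (lam : ι → ℝ) {ω : ι → ℝ} (hω : ∀ i, 0 < ω i)
    (h : ∃ i, lam i ≠ 0) :
    zBStatic (deltaU lam ω) (Real.sqrt (lowPoleSq lam ω)) ≤ zBModes lam ω ∧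
      zBModes lam ω ≤ zBStatic (deltaU lam ω) (Real.sqrt (highPoleSq lam ω)) := by
  have hA := momA_pos lam hω h
  have hB := momB_pos lam hω h
  have hC := momC_pos lam hω h
  have hD := momD_pos lam hω h
  have hdU : 0 ≤ deltaU lam ω := deltaU_nonneg lam hω
  have hZ : zBModes lam ω = zBStatic (deltaU lam ω) (omegaChar lam ω) :=
    zBModes_eq_zBStatic lam ω hA.ne' hB.ne'
  have hωbar : 0 < omegaChar lam ω := by unfold omegaChar; exact div_pos hA hB
  have hlow : 0 < Real.sqrt (lowPoleSq lam ω) :=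
    Real.sqrt_pos.mpr (by unfold lowPoleSq; exact div_pos hA hC)
  have hhigh : 0 < Real.sqrt (highPoleSq lam ω) :=
    Real.sqrt_pos.mpr (by unfold highPoleSq; exact div_pos hD hA)
  rw [hZ]
  exact ⟨zBStatic_monotoneOn_omega hdU hlow hωbar (sqrt_lowPoleSq_le_omegaChar lam hω h),
    zBStatic_monotoneOn_omega hdU hωbar hhigh (omegaChar_le_sqrt_highPoleSq lam hω h)⟩

end TwoPointBracket

end DynU

end Literature.MathematicalPhysics.QuantumLattice
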